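import Mathlib
import Summits.AtomisticToContinuum.Crystallization.Theorems.SquareWellLayerCakeStackingFaultSparsityExactLatticeLedgerSiteRim

/-!
# Exact-lattice ledger, VI: the truncation tails of the remainder (helper file)

Crux `StackingFaultSparsity` (item stmt-AtomisticToContinuum-14296, routes `SquareWellLayerCake` /
`LaminarSixThreeThree`), line `Sketch`, stub `stub_exactLatticeLedger` (survey obligation M3c+e, the
exact-lattice ledger of the cylinder block flip; landing file
`SquareWellLayerCakeStackingFaultSparsityExactLatticeLedger.lean`, whose module docstring has the
overall map).

`ledger_up_site_tails` (carrier): the full-layer-minus-window tails of the remainder at a disc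
site, new and old, are each `≤ 11000 max(depth - 2, 1/2)⁻³`.
-/

noncomputable section
namespace Summit.AtomisticToContinuum.Crystallization.Theorems.SquareWellLayerCake.StackingFaultSparsity
open Literature.MathematicalPhysics.StatisticalMechanics

/-! ## 5c. The truncation tails at a disc site -/

/-- **The truncation tails of the remainder at a disc site** (part (ii) of `ledger_up_site_error`):
the full-layer sums minus the window sums, new and old, summed over the layers `q.1 + k`, are each
`≤ 11000 · max(depth - 2, 1/2)⁻³` — the missing points lie beyond `R` from the base, hence
`≥ 1 + depth` from the site (`one_add_depth_le`), `≥ depth - 1/5` after the shifts; the families are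
summable (`summable_lennardJones_shift_layer`) and every finite partial sum is a shell sum over an
injectively indexed `1/2`-separated family (`sum_abs_lennardJones_family_le`). [folklore] -/
theorem ledger_up_site_tails : ∀ K : ℕ, 2 ≤ K →
    ∀ (a h : ℝ) (s : ℤ → ℤ) (q₁ q₂ i₀ j₀ : ℤ) (ρ R : ℝ) (I : Finset (ℤ × ℤ × ℤ))
      (D : ℤ × ℤ × ℤ → (EuclideanSpace ℝ (Fin 3))) (Δ : ℤ × ℤ × ℤ → ℤ × ℤ × ℤ → ℝ),
      InBox a h → IsHaggSeq s → q₁ < q₂ → (3 : ℤ) ∣ haggLabel s q₂ - haggLabel s q₁ → 1 ≤ ρ →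
      ρ + ((q₂ : ℝ) - q₁) * h + K * h + 1 ≤ R →
      (∀ q, InCyl a h s q₁ q₂ i₀ j₀ ρ q.1 q.2.1 q.2.2 →
        D q = ((shiftSign s q₁ q.1 : ℤ) : ℝ) • barlowOffset a) →
      (∀ q, ¬ InCyl a h s q₁ q₂ i₀ j₀ ρ q.1 q.2.1 q.2.2 → D q = 0) →
      (∀ q q', Δ q q' =
        lennardJones (dist (barlowPos a h s q.1 q.2.1 q.2.2 + D q)
            (barlowPos a h s q'.1 q'.2.1 q'.2.2 + D q')) -
          lennardJones (dist (barlowPos a h s q.1 q.2.1 q.2.2)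
            (barlowPos a h s q'.1 q'.2.1 q'.2.2))) →
      (∀ q, q ∈ I ↔ dist (barlowPos a h s q.1 q.2.1 q.2.2) (barlowPos a h s q₁ i₀ j₀) ≤ R) →
      ∀ q ∈ I, q.1 ∈ Finset.Icc (q₁ - K) q₂ → (latSq (barlowPos a h s q.1 q.2.1 q.2.2) (barlowPos a h s q₁ i₀ j₀) ≤ ρ ^ 2) →
        (∑ k ∈ Finset.Icc 1 K,
          ∑' ij : ↥((↑((I.filter (fun q' => q'.1 = q.1 + k)).image (fun q' => q'.2)) : Set (ℤ × ℤ))ᶜ),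
            |lennardJones (dist (barlowPos a h s q.1 q.2.1 q.2.2 + D q)
              (barlowPos a h s (q.1 + k) ij.1.1 ij.1.2 + (((fun n : ℤ => if q₁ < n ∧ n < q₂ then shiftSign s q₁ n else 0) (q.1 + k) : ℤ) : ℝ) • barlowOffset a))| ≤
          11000 * (max (ρ - √(latSq (barlowPos a h s q.1 q.2.1 q.2.2) (barlowPos a h s q₁ i₀ j₀)) - 2) (1 / 2))⁻¹ ^ 3) ∧
        (∑ k ∈ Finset.Icc 1 K,
          ∑' ij : ↥((↑((I.filter (fun q' => q'.1 = q.1 + k)).image (fun q' => q'.2)) : Set (ℤ × ℤ))ᶜ),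
            |lennardJones (dist (barlowPos a h s q.1 q.2.1 q.2.2) (barlowPos a h s (q.1 + k) ij.1.1 ij.1.2))| ≤
          11000 * (max (ρ - √(latSq (barlowPos a h s q.1 q.2.1 q.2.2) (barlowPos a h s q₁ i₀ j₀)) - 2) (1 / 2))⁻¹ ^ 3) := by
  intro K hK a h s q₁ q₂ i₀ j₀ ρ R I D Δ hbox hs hq hcharge hρ hR hD₁ hD₀ hΔ hI q hqI hm hdisc
  classical
  obtain ⟨ha, hh⟩ := InBox.pos hbox
  obtain ⟨ha1, ha1', hh7, -⟩ := InBox.bounds hbox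
  have hρ0 : 0 ≤ ρ := by linarith
  have hdepth := one_add_depth_le K hK a h s q₁ q₂ i₀ j₀ ρ R I D Δ hbox hs hq hcharge hρ hR hD₁ hD₀ hΔ hI
    q hm hdisc
  -- the extended registry sign and the displacement of the site
  have hτv : ∀ n : ℤ, (fun n : ℤ => if q₁ < n ∧ n < q₂ then shiftSign s q₁ n else 0) n = 0 ∨ (fun n : ℤ => if q₁ < n ∧ n < q₂ then shiftSign s q₁ n else 0) n = 1 ∨ (fun n : ℤ => if q₁ < n ∧ n < q₂ then shiftSign s q₁ n else 0) n = -1 := by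
    intro n
    simp only
    split_ifs
    · exact shiftSign_cases s q₁ n
    · exact Or.inl rfl
  have hDq : D q = (((fun n : ℤ => if q₁ < n ∧ n < q₂ then shiftSign s q₁ n else 0) q.1 : ℤ) : ℝ) • barlowOffset a := by
    by_cases hmid : q₁ < q.1 ∧ q.1 < q₂
    · rw [hD₁ q ⟨hmid.1, hmid.2, hdisc⟩]
      simp only [hmid, and_self, if_true]
    · rw [hD₀ q (fun hc => hmid ⟨hc.1, hc.2.1⟩)]
      simp only [hmid, if_false, Int.cast_zero, zero_smul]
  -- depth and the target
  set t : ℝ := ρ - √(latSq (barlowPos a h s q.1 q.2.1 q.2.2) (barlowPos a h s q₁ i₀ j₀)) with ht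
  set M : ℝ := max (t - 2) (1 / 2) with hM
  have hM2 : 1 / 2 ≤ M := le_max_right _ _
  have hM0 : 0 < M := by linarith
  have hMt : t - 2 ≤ M := le_max_left _ _
  have ht0 : 0 ≤ t := by
    have h1 : √(latSq (barlowPos a h s q.1 q.2.1 q.2.2) (barlowPos a h s q₁ i₀ j₀)) ≤ ρ := by
      rw [← Real.sqrt_sq hρ0]; exact Real.sqrt_le_sqrt hdisc
    rw [ht]; linarith
  have hM1t : M ≤ 1 + t := max_le (by linarith) (by linarith)
  -- lateral facts about the site
  have hlat_site : √(latSq (barlowPos a h s q.1 q.2.1 q.2.2 + D q) (barlowPos a h s q.1 q.2.1 q.2.2)) ≤ 3 / 5 :=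
    sqrt_latSq_disp_le hbox hD₁ hD₀ q _
  have hnormD : ‖D q‖ ≤ 3 / 5 := by rw [hDq]; exact norm_zsmul_barlowOffset_le hbox (hτv q.1)
  -- partners outside the disc are laterally `> t` away
  have hlat_out : ∀ q' : ℤ × ℤ × ℤ, ¬ (latSq (barlowPos a h s q'.1 q'.2.1 q'.2.2) (barlowPos a h s q₁ i₀ j₀) ≤ ρ ^ 2) →
      t < √(latSq (barlowPos a h s q.1 q.2.1 q.2.2) (barlowPos a h s q'.1 q'.2.1 q'.2.2)) := by
    intro q' hd'
    have h1 : ρ < √(latSq (barlowPos a h s q'.1 q'.2.1 q'.2.2) (barlowPos a h s q₁ i₀ j₀)) := by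
      rw [← Real.sqrt_sq hρ0]
      exact Real.sqrt_lt_sqrt (sq_nonneg ρ) (not_le.1 hd')
    have h2 := sqrt_latSq_triangle (barlowPos a h s q'.1 q'.2.1 q'.2.2) (barlowPos a h s q.1 q.2.1 q.2.2)
      (barlowPos a h s q₁ i₀ j₀)
    rw [latSq_comm (barlowPos a h s q'.1 q'.2.1 q'.2.2) (barlowPos a h s q.1 q.2.1 q.2.2)] at h2
    linarith
  -- vertical gap of an UP-partner
  have hvert : ∀ (k : ℕ), 1 ≤ k → ∀ (ij : ℤ × ℤ) (σ σ' : ℤ),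
      7 / 10 ≤ dist (barlowPos a h s q.1 q.2.1 q.2.2 + (σ : ℝ) • barlowOffset a)
        (barlowPos a h s (q.1 + k) ij.1 ij.2 + (σ' : ℝ) • barlowOffset a) := by
    intro k hk ij σ σ'
    have h1 := abs_sub_mul_le_dist_barlowPos_add_zsmul a h s q.1 q.2.1 q.2.2 σ (q.1 + k) ij.1 ij.2 σ'
    have hk1 : (1 : ℝ) ≤ k := by exact_mod_cast hk
    have h2 : 7 / 10 ≤ |((q.1 : ℝ) - ((q.1 + k : ℤ) : ℝ)) * h| := by
      push_cast
      rw [show ((q.1 : ℝ) - (q.1 + k)) * h = -(k * h) by ring, abs_neg, abs_of_pos (by positivity)]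
      nlinarith
    exact h2.trans h1
  -- reindexing of the finite window sums by in-layer indices
  have hF : ∀ (k : ℕ) (g : ℤ × ℤ × ℤ → ℝ), ∑ q' ∈ I.filter (fun q' => q'.1 = q.1 + k), g q' =
      ∑ ij ∈ (I.filter (fun q' => q'.1 = q.1 + k)).image (fun q' => q'.2), g (q.1 + k, ij) := by
    intro k g
    rw [Finset.sum_image]
    · refine Finset.sum_congr rfl fun q' hq' => ?_
      rw [Finset.mem_filter] at hq'
      rw [← hq'.2, Prod.mk.eta]
    · intro q' hq' q'' hq'' hqq
      rw [Finset.coe_filter, Set.mem_setOf_eq] at hq' hq''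
      exact Prod.ext (hq'.2.trans hq''.2.symm) hqq
  have hFmem : ∀ (k : ℕ) (ij : ℤ × ℤ), ij ∈ (I.filter (fun q' => q'.1 = q.1 + k)).image (fun q' => q'.2) ↔
      ((q.1 + k, ij) : ℤ × ℤ × ℤ) ∈ I := by
    intro k ij
    rw [Finset.mem_image]
    constructor
    · rintro ⟨q', hq', rfl⟩
      rw [Finset.mem_filter] at hq'
      obtain ⟨h1, h2⟩ := hq'
      have : q' = (q.1 + k, q'.2) := Prod.ext h2 rfl
      rw [this] at h1
      exact h1
    · intro h1
      exact ⟨(q.1 + k, ij), Finset.mem_filter.2 ⟨h1, rfl⟩, rfl⟩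
  -- summability of the layer families
  have hsumO : ∀ k : ℕ, 1 ≤ k → Summable (fun ij : ℤ × ℤ =>
      lennardJones (dist (barlowPos a h s q.1 q.2.1 q.2.2) (barlowPos a h s (q.1 + k) ij.1 ij.2))) := by
    intro k hk
    have := summable_lennardJones_shift_layer ha hh s q.1 q.2.1 q.2.2 (q.1 + k) 0 0 (by omega)
    simpa using this
  have hsumN : ∀ k : ℕ, 1 ≤ k → Summable (fun ij : ℤ × ℤ =>
      lennardJones (dist (barlowPos a h s q.1 q.2.1 q.2.2 + D q)
        (barlowPos a h s (q.1 + k) ij.1 ij.2 + (((fun n : ℤ => if q₁ < n ∧ n < q₂ then shiftSign s q₁ n else 0) (q.1 + k) : ℤ) : ℝ) • barlowOffset a))) := by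
    intro k hk
    rw [hDq]
    exact summable_lennardJones_shift_layer ha hh s q.1 q.2.1 q.2.2 (q.1 + k) _ _ (by omega)
  -- a tail index is beyond `R`, hence `≥ 1 + t` from the site
  have htail_far : ∀ (k : ℕ) (ij : ℤ × ℤ), ij ∉ (I.filter (fun q' => q'.1 = q.1 + k)).image (fun q' => q'.2) →
      1 + t ≤ dist (barlowPos a h s q.1 q.2.1 q.2.2) (barlowPos a h s (q.1 + k) ij.1 ij.2) := by
    intro k ij hij
    rw [hFmem] at hij
    rw [hI] at hij
    exact hdepth _ (not_le.1 hij)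
  -- joint finite bound for the old tail
  have hJ3fin : ∀ u : Finset (ℤ × ℤ), ∑ ij ∈ u, ∑ k ∈ Finset.Icc 1 K,
      (if ij ∈ (I.filter (fun q' => q'.1 = q.1 + k)).image (fun q' => q'.2) then 0 else
        |lennardJones (dist (barlowPos a h s q.1 q.2.1 q.2.2) (barlowPos a h s (q.1 + k) ij.1 ij.2))|) ≤
      11000 * M⁻¹ ^ 3 := by
    intro u
    rw [Finset.sum_comm]
    refine le_trans (le_of_eq (Finset.sum_product' (Finset.Icc 1 K) u (fun k ij =>
      (if ij ∈ (I.filter (fun q' => q'.1 = q.1 + k)).image (fun q' => q'.2) then 0 else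
        |lennardJones (dist (barlowPos a h s q.1 q.2.1 q.2.2) (barlowPos a h s (q.1 + k) ij.1 ij.2))|))).symm) ?_
    rw [Finset.sum_ite, Finset.sum_const_zero, zero_add]
    refine sum_abs_lennardJones_family_le _ (fun p : ℕ × (ℤ × ℤ) => barlowPos a h s (q.1 + p.1) p.2.1 p.2.2) _
      hM2 ?_ ?_ ?_
    · intro p hp p' hp' hpp
      have h1 := barlowPos_injective ha hh s (a₁ := (q.1 + p.1, p.2.1, p.2.2)) (a₂ := (q.1 + p'.1, p'.2.1, p'.2.2)) hpp
      simp only [Prod.mk.injEq] at h1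
      exact Prod.ext (by exact_mod_cast (show (p.1 : ℤ) = p'.1 by omega)) (Prod.ext h1.2.1 h1.2.2)
    · intro p _ p' _ hne
      refine half_le_dist_old hbox s (q := (q.1 + p.1, p.2.1, p.2.2)) (q' := (q.1 + p'.1, p'.2.1, p'.2.2)) ?_
      intro h0
      simp only [Prod.mk.injEq] at h0
      exact hne (Prod.ext (by exact_mod_cast (show (p.1 : ℤ) = p'.1 by omega)) (Prod.ext h0.2.1 h0.2.2))
    · intro p hp
      rw [Finset.mem_filter, Finset.mem_product] at hp
      have h1 := htail_far p.1 p.2 hp.2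
      linarith [hM1t]
  -- joint finite bound for the new tail
  have hJ2fin : ∀ u : Finset (ℤ × ℤ), ∑ ij ∈ u, ∑ k ∈ Finset.Icc 1 K,
      (if ij ∈ (I.filter (fun q' => q'.1 = q.1 + k)).image (fun q' => q'.2) then 0 else
        |lennardJones (dist (barlowPos a h s q.1 q.2.1 q.2.2 + D q)
          (barlowPos a h s (q.1 + k) ij.1 ij.2 + (((fun n : ℤ => if q₁ < n ∧ n < q₂ then shiftSign s q₁ n else 0) (q.1 + k) : ℤ) : ℝ) • barlowOffset a))|) ≤
      11000 * M⁻¹ ^ 3 := by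
    intro u
    rw [Finset.sum_comm]
    refine le_trans (le_of_eq (Finset.sum_product' (Finset.Icc 1 K) u (fun k ij =>
      (if ij ∈ (I.filter (fun q' => q'.1 = q.1 + k)).image (fun q' => q'.2) then 0 else
        |lennardJones (dist (barlowPos a h s q.1 q.2.1 q.2.2 + D q)
          (barlowPos a h s (q.1 + k) ij.1 ij.2 + (((fun n : ℤ => if q₁ < n ∧ n < q₂ then shiftSign s q₁ n else 0) (q.1 + k) : ℤ) : ℝ) • barlowOffset a))|))).symm) ?_
    rw [Finset.sum_ite, Finset.sum_const_zero, zero_add]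
    refine sum_abs_lennardJones_family_le _
      (fun p : ℕ × (ℤ × ℤ) => barlowPos a h s (q.1 + p.1) p.2.1 p.2.2 +
        (((fun n : ℤ => if q₁ < n ∧ n < q₂ then shiftSign s q₁ n else 0) (q.1 + p.1) : ℤ) : ℝ) • barlowOffset a) _ hM2 ?_ ?_ ?_
    · intro p hp p' hp' hpp
      have h1 := shiftFamily_injective ha hh s (fun n : ℤ => if q₁ < n ∧ n < q₂ then shiftSign s q₁ n else 0) (q := (q.1 + p.1, p.2.1, p.2.2))
        (q' := (q.1 + p'.1, p'.2.1, p'.2.2)) hpp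
      simp only [Prod.mk.injEq] at h1
      exact Prod.ext (by exact_mod_cast (show (p.1 : ℤ) = p'.1 by omega)) (Prod.ext h1.2.1 h1.2.2)
    · intro p _ p' _ hne
      refine (InBox.half_le_min hbox).trans (le_dist_barlowPos_add_zsmul a h s ha.le _ _ _ _ _ _ _ _ ?_)
      intro h0
      have h1 := shiftFamily_injective ha hh s (fun n : ℤ => if q₁ < n ∧ n < q₂ then shiftSign s q₁ n else 0) (q := (q.1 + p.1, p.2.1, p.2.2))
        (q' := (q.1 + p'.1, p'.2.1, p'.2.2)) h0
      simp only [Prod.mk.injEq] at h1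
      exact hne (Prod.ext (by exact_mod_cast (show (p.1 : ℤ) = p'.1 by omega)) (Prod.ext h1.2.1 h1.2.2))
    · intro p hp
      rw [Finset.mem_filter, Finset.mem_product, Finset.mem_Icc] at hp
      have h1 := htail_far p.1 p.2 hp.2
      refine max_le ?_ ?_
      · -- `dist ≥ (1 + t) - 3/5 - 3/5`
        have h2 := dist_triangle (barlowPos a h s q.1 q.2.1 q.2.2) (barlowPos a h s q.1 q.2.1 q.2.2 + D q)
          (barlowPos a h s (q.1 + p.1) p.2.1 p.2.2)
        have h3 := dist_triangle (barlowPos a h s q.1 q.2.1 q.2.2 + D q)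
          (barlowPos a h s (q.1 + p.1) p.2.1 p.2.2 + (((fun n : ℤ => if q₁ < n ∧ n < q₂ then shiftSign s q₁ n else 0) (q.1 + p.1) : ℤ) : ℝ) • barlowOffset a)
          (barlowPos a h s (q.1 + p.1) p.2.1 p.2.2)
        have h4 : dist (barlowPos a h s q.1 q.2.1 q.2.2) (barlowPos a h s q.1 q.2.1 q.2.2 + D q) ≤ 3 / 5 := by
          rw [dist_comm, dist_eq_norm, add_sub_cancel_left]; exact hnormD
        have h5 : dist (barlowPos a h s (q.1 + p.1) p.2.1 p.2.2 + (((fun n : ℤ => if q₁ < n ∧ n < q₂ then shiftSign s q₁ n else 0) (q.1 + p.1) : ℤ) : ℝ) • barlowOffset a)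
            (barlowPos a h s (q.1 + p.1) p.2.1 p.2.2) ≤ 3 / 5 := by
          rw [dist_eq_norm, add_sub_cancel_left]; exact norm_zsmul_barlowOffset_le hbox (hτv _)
        linarith
      · rw [hDq]
        have := hvert p.1 hp.1.1.1 p.2 ((fun n : ℤ => if q₁ < n ∧ n < q₂ then shiftSign s q₁ n else 0) q.1) ((fun n : ℤ => if q₁ < n ∧ n < q₂ then shiftSign s q₁ n else 0) (q.1 + p.1))
        linarith
  -- from the finite bounds to the tails
  have htailO : ∑ k ∈ Finset.Icc 1 K,
      ∑' ij : ↥((↑((I.filter (fun q' => q'.1 = q.1 + k)).image (fun q' => q'.2)) : Set (ℤ × ℤ))ᶜ),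
        |lennardJones (dist (barlowPos a h s q.1 q.2.1 q.2.2) (barlowPos a h s (q.1 + k) ij.1.1 ij.1.2))| ≤
      11000 * M⁻¹ ^ 3 := by
    have e1 : ∀ k ∈ Finset.Icc 1 K,
        ∑' ij : ↥((↑((I.filter (fun q' => q'.1 = q.1 + k)).image (fun q' => q'.2)) : Set (ℤ × ℤ))ᶜ),
          |lennardJones (dist (barlowPos a h s q.1 q.2.1 q.2.2) (barlowPos a h s (q.1 + k) ij.1.1 ij.1.2))| =
        ∑' ij : ℤ × ℤ, (if ij ∈ (I.filter (fun q' => q'.1 = q.1 + k)).image (fun q' => q'.2) then 0 else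
          |lennardJones (dist (barlowPos a h s q.1 q.2.1 q.2.2) (barlowPos a h s (q.1 + k) ij.1 ij.2))|) := by
      intro k _
      rw [tsum_subtype ((↑((I.filter (fun q' => q'.1 = q.1 + k)).image (fun q' => q'.2)) : Set (ℤ × ℤ))ᶜ)
        (fun ij : ℤ × ℤ => |lennardJones (dist (barlowPos a h s q.1 q.2.1 q.2.2) (barlowPos a h s (q.1 + k) ij.1 ij.2))|)]
      refine tsum_congr fun ij => ?_
      by_cases hij : ij ∈ (I.filter (fun q' => q'.1 = q.1 + k)).image (fun q' => q'.2)
      · rw [if_pos hij, Set.indicator_of_notMem]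
        simpa only [Set.mem_compl_iff, Finset.mem_coe, not_not] using hij
      · rw [if_neg hij, Set.indicator_of_mem]
        simpa only [Set.mem_compl_iff, Finset.mem_coe] using hij
    rw [Finset.sum_congr rfl e1]
    have hs : ∀ k ∈ Finset.Icc 1 K, Summable (fun ij : ℤ × ℤ =>
        (if ij ∈ (I.filter (fun q' => q'.1 = q.1 + k)).image (fun q' => q'.2) then 0 else
          |lennardJones (dist (barlowPos a h s q.1 q.2.1 q.2.2) (barlowPos a h s (q.1 + k) ij.1 ij.2))|)) := by
      intro k hk
      rw [Finset.mem_Icc] at hk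
      refine Summable.of_nonneg_of_le (fun ij => by split_ifs <;> simp) (fun ij => ?_) (hsumO k hk.1).abs
      split_ifs <;> simp
    rw [← Summable.tsum_finsetSum hs]
    refine Real.tsum_le_of_sum_le (fun ij => Finset.sum_nonneg fun k _ => by split_ifs <;> simp) hJ3fin
  have htailN : ∑ k ∈ Finset.Icc 1 K,
      ∑' ij : ↥((↑((I.filter (fun q' => q'.1 = q.1 + k)).image (fun q' => q'.2)) : Set (ℤ × ℤ))ᶜ),
        |lennardJones (dist (barlowPos a h s q.1 q.2.1 q.2.2 + D q)
          (barlowPos a h s (q.1 + k) ij.1.1 ij.1.2 + (((fun n : ℤ => if q₁ < n ∧ n < q₂ then shiftSign s q₁ n else 0) (q.1 + k) : ℤ) : ℝ) • barlowOffset a))| ≤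
      11000 * M⁻¹ ^ 3 := by
    have e1 : ∀ k ∈ Finset.Icc 1 K,
        ∑' ij : ↥((↑((I.filter (fun q' => q'.1 = q.1 + k)).image (fun q' => q'.2)) : Set (ℤ × ℤ))ᶜ),
          |lennardJones (dist (barlowPos a h s q.1 q.2.1 q.2.2 + D q)
            (barlowPos a h s (q.1 + k) ij.1.1 ij.1.2 + (((fun n : ℤ => if q₁ < n ∧ n < q₂ then shiftSign s q₁ n else 0) (q.1 + k) : ℤ) : ℝ) • barlowOffset a))| =
        ∑' ij : ℤ × ℤ, (if ij ∈ (I.filter (fun q' => q'.1 = q.1 + k)).image (fun q' => q'.2) then 0 else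
          |lennardJones (dist (barlowPos a h s q.1 q.2.1 q.2.2 + D q)
            (barlowPos a h s (q.1 + k) ij.1 ij.2 + (((fun n : ℤ => if q₁ < n ∧ n < q₂ then shiftSign s q₁ n else 0) (q.1 + k) : ℤ) : ℝ) • barlowOffset a))|) := by
      intro k _
      rw [tsum_subtype ((↑((I.filter (fun q' => q'.1 = q.1 + k)).image (fun q' => q'.2)) : Set (ℤ × ℤ))ᶜ)
        (fun ij : ℤ × ℤ => |lennardJones (dist (barlowPos a h s q.1 q.2.1 q.2.2 + D q)
            (barlowPos a h s (q.1 + k) ij.1 ij.2 + (((fun n : ℤ => if q₁ < n ∧ n < q₂ then shiftSign s q₁ n else 0) (q.1 + k) : ℤ) : ℝ) • barlowOffset a))|)]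
      refine tsum_congr fun ij => ?_
      by_cases hij : ij ∈ (I.filter (fun q' => q'.1 = q.1 + k)).image (fun q' => q'.2)
      · rw [if_pos hij, Set.indicator_of_notMem]
        simpa only [Set.mem_compl_iff, Finset.mem_coe, not_not] using hij
      · rw [if_neg hij, Set.indicator_of_mem]
        simpa only [Set.mem_compl_iff, Finset.mem_coe] using hij
    rw [Finset.sum_congr rfl e1]
    have hs : ∀ k ∈ Finset.Icc 1 K, Summable (fun ij : ℤ × ℤ =>
        (if ij ∈ (I.filter (fun q' => q'.1 = q.1 + k)).image (fun q' => q'.2) then 0 else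
          |lennardJones (dist (barlowPos a h s q.1 q.2.1 q.2.2 + D q)
            (barlowPos a h s (q.1 + k) ij.1 ij.2 + (((fun n : ℤ => if q₁ < n ∧ n < q₂ then shiftSign s q₁ n else 0) (q.1 + k) : ℤ) : ℝ) • barlowOffset a))|)) := by
      intro k hk
      rw [Finset.mem_Icc] at hk
      refine Summable.of_nonneg_of_le (fun ij => by split_ifs <;> simp) (fun ij => ?_) (hsumN k hk.1).abs
      split_ifs <;> simp
    rw [← Summable.tsum_finsetSum hs]
    refine Real.tsum_le_of_sum_le (fun ij => Finset.sum_nonneg fun k _ => by split_ifs <;> simp) hJ2fin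
  exact ⟨htailN, htailO⟩

end Summit.AtomisticToContinuum.Crystallization.Theorems.SquareWellLayerCake.StackingFaultSparsity

end
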